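import Summits.QuantumFields.YangMills.Theorems.IR.BetaSlopeFloorTransport
import Literature.MathematicalPhysics.QuantumFieldTheory.SpeciesTimeReflection

/-!
# Line `beta-slope-floor` (crux `IR`, stmt-QuantumFields-19354): slice species are fixed by the time reflection

Route `BalabanLadder`, crux `IR`, line `beta-slope-floor` (ideator ym-ir-idea-2), lead prover `ym-ir-line-bsf-p1`.
Bookkeeping for the lead's recommended re-typing of the line's XL step (skeleton v2 §5, `ReflSlopeFloor`: the
β-slope floor for the two REFLECTED antipodal clauses `c_{ΘA,A}(S;S)`, `c_{A,ΘA}(S;S)` of every species):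

* `cfgReflect_apply_of_slice` — the site time reflection `Θ₀` of `ℤ⁴` gauge fields fixes every time-zero
  spatial link variable;
* `timeReflect_F_of_isSliceObs` — hence a time-zero spatial ("slice") species `A` and its reflection `ΘA`
  have the SAME underlying function, and (`latticeConnectedCorr_timeReflect_*_of_isSliceObs`) both reflected
  clauses of a slice species are its diagonal correlator `D_b(A;S,n) = latticeConnectedCorr r.ρ b (2S+1) A A n`;
* `reflSlopeFloor_slice_of_slopeFloor` — consequently the filed floor `SlopeFloor r a` (slice species, all
  `n ≤ S`) implies the re-typed floor RESTRICTED TO SLICE SPECIES (antipodal index `n = S`): the re-typing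
  changes the critics' XL statement only by (a) enlarging the observable class from slice species to all species
  and (b) keeping the antipodal index alone (both statements δ-unfolded here; the skeleton keeps the `def`s).

Group-blind plumbing; carries no gap content; nothing here proves the Yang–Mills mass gap (Clay); R4 closes only the
conditional finite-𝕋⁴ rung `BalabanLadder.UV`.
Refs: K. Osterwalder, E. Seiler, Ann. Phys. 110 (1978) §2 (site reflection); tree `SpeciesTimeReflection`.
-/

set_option autoImplicit false

noncomputable section

open MeasureTheory Filter Topology
open Literature.MathematicalPhysics.QuantumFieldTheory Literature.MathematicalPhysics.QuantumLattice

namespace Summit.QuantumFields.YangMills.Cruxes.IR.BetaSlopeFloor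

section Reflection

variable {G : Type} [Group G]

/-- **The site time reflection fixes the time-zero spatial links**: for an edge `e = (x, i)` with `x₀ = 0` and
`i ≠ 0`, `(Θ₀U)(e) = U(e)`. -/
theorem cfgReflect_apply_of_slice (U : LGConfig 4 G)
    {e : Literature.MathematicalPhysics.QuantumLattice.ZdEdge 4} (he0 : e.1 0 = 0) (he2 : e.2 ≠ 0) :
    cfgReflect U e = U e := by
  have hx : siteReflect e.1 = e.1 := by
    funext k
    by_cases hk : k = 0
    · subst hk; rw [siteReflect_apply_zero, he0, neg_zero]
    · exact siteReflect_apply_of_ne _ hk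
  rw [show cfgReflect U e = U (reflectEdge e) by simp only [cfgReflect, if_neg he2]]
  simp only [reflectEdge, if_neg he2, hx]

end Reflection

variable {G : Type} [Group G] [TopologicalSpace G] [IsTopologicalGroup G] [CompactSpace G]
  [MeasurableSpace G] [BorelSpace G]

omit [CompactSpace G] in
/-- **A slice species is fixed by the time reflection** (as a function of the gauge field): if every link of
`A.supp` is a time-zero spatial link then `(ΘA).F = A.F`. -/
theorem timeReflect_F_of_isSliceObs (A : YMSpecies G) (hA : ∀ e ∈ A.supp, e.1 0 = 0 ∧ e.2 ≠ 0) :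
    A.timeReflect.F = A.F := by
  funext U
  rw [LocalGaugeObservable.timeReflect_F]
  exact A.isCylinder fun e he => cfgReflect_apply_of_slice U (hA e he).1 (hA e he).2

/-- For a slice species the first reflected clause `c_{ΘA,B}` is the plain correlator `c_{A,B}`. -/
theorem latticeConnectedCorr_timeReflect_left_of_isSliceObs {N : ℕ} (ρ : G →* Matrix (Fin N) (Fin N) ℂ)
    (β : ℝ) (L : ℕ) [NeZero L] (A : YMSpecies G) (hA : ∀ e ∈ A.supp, e.1 0 = 0 ∧ e.2 ≠ 0)
    (B : LGConfig 4 G → ℝ) (n : ℕ) :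
    latticeConnectedCorr ρ β L A.timeReflect.F B n = latticeConnectedCorr ρ β L A.F B n := by
  rw [timeReflect_F_of_isSliceObs A hA]

/-- For a slice species the second reflected clause `c_{B,ΘA}` is the plain correlator `c_{B,A}`. -/
theorem latticeConnectedCorr_timeReflect_right_of_isSliceObs {N : ℕ} (ρ : G →* Matrix (Fin N) (Fin N) ℂ)
    (β : ℝ) (L : ℕ) [NeZero L] (A : YMSpecies G) (hA : ∀ e ∈ A.supp, e.1 0 = 0 ∧ e.2 ≠ 0)
    (B : LGConfig 4 G → ℝ) (n : ℕ) :
    latticeConnectedCorr ρ β L B A.timeReflect.F n = latticeConnectedCorr ρ β L B A.F n := by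
  rw [timeReflect_F_of_isSliceObs A hA]

/-- **The filed slope floor implies the re-typed (reflected, antipodal) floor on slice species.**  With the
skeleton's `SlopeFloor` δ-unfolded as hypothesis: for the SAME `c, β₂, S₁` and per-species `K_A`, every slice
species satisfies the two reflected antipodal floor clauses `(c·a(β)·S − K_A)·R_b ≤ ∂_b R_b`,
`R = c_{ΘA,A}(S;S), c_{A,ΘA}(S;S)`, on the unit windows `b ∈ [β, β+1]` (take `n = S` and `ΘA = A` as functions). -/
theorem reflSlopeFloor_slice_of_slopeFloor (r : LatticeRep G) (a : ℝ → ℝ)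
    (h : ∃ (c β₂ : ℝ) (S₁ : ℝ → ℕ), 0 < c ∧ ∀ A : YMSpecies G, (∀ e ∈ A.supp, e.1 0 = 0 ∧ e.2 ≠ 0) →
      ∃ K : ℝ, ∀ β : ℝ, β₂ ≤ β → ∀ S n : ℕ, S₁ β ≤ S → n ≤ S → ∀ b : ℝ, β ≤ b → b ≤ β + 1 →
        (c * a β * n - K) * latticeConnectedCorr r.ρ b (2 * S + 1) A.F A.F n ≤
          deriv (fun b' => latticeConnectedCorr r.ρ b' (2 * S + 1) A.F A.F n) b) :
    ∃ (c β₂ : ℝ) (S₁ : ℝ → ℕ), 0 < c ∧ ∀ A : YMSpecies G, (∀ e ∈ A.supp, e.1 0 = 0 ∧ e.2 ≠ 0) →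
      ∃ K : ℝ, ∀ β : ℝ, β₂ ≤ β → ∀ S : ℕ, S₁ β ≤ S → ∀ b : ℝ, β ≤ b → b ≤ β + 1 →
        (c * a β * S - K) * latticeConnectedCorr r.ρ b (2 * S + 1) A.timeReflect.F A.F S ≤
            deriv (fun b' => latticeConnectedCorr r.ρ b' (2 * S + 1) A.timeReflect.F A.F S) b ∧
          (c * a β * S - K) * latticeConnectedCorr r.ρ b (2 * S + 1) A.F A.timeReflect.F S ≤
            deriv (fun b' => latticeConnectedCorr r.ρ b' (2 * S + 1) A.F A.timeReflect.F S) b := by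
  obtain ⟨c, β₂, S₁, hc, h⟩ := h
  refine ⟨c, β₂, S₁, hc, fun A hA => ?_⟩
  obtain ⟨K, hK⟩ := h A hA
  refine ⟨K, fun β hβ S hS b hb1 hb2 => ?_⟩
  have h1 := hK β hβ S S hS le_rfl b hb1 hb2
  simp only [timeReflect_F_of_isSliceObs A hA]
  exact ⟨h1, h1⟩

end Summit.QuantumFields.YangMills.Cruxes.IR.BetaSlopeFloor

end
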